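import Literature.Geometry.Kaehler.LocalPQForms
import Literature.Geometry.Kaehler.ChartTransport
import Literature.Geometry.Kaehler.ChartDolbeaultOps
import Literature.Analysis.Complex.HolomorphicFlatForms
import HarnessLib

/-!
# Holomorphic `p`-forms on a chart set are the holomorphic maps on the chart (Huybrechts 2.6.11, in a chart)

For a complex manifold `M` modelled on the finite-dimensional `E`, a chart centre `x₀` and an
open `C` inside the target of the chart at `x₀`, the `(p,0)`-forms on the chart set
`chartSet 𝓘(ℝ, E) x₀ C` (in the sense of `LocalPQForms`: type `(p,0)`, smooth there, zero off it)
which are `∂̄`-closed there — the holomorphic `p`-forms `Ω^p(chartSet x₀ C)` — correspond exactly,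
through the chart representative `α ↦ α.inChart x₀` and back through
`MForm.ofChartOn x₀ (chartSet x₀ C)` (`ChartTransport`), to the maps `C → Λ^{p,0}` which are
COMPLEX-DIFFERENTIABLE on `C` (D. Huybrechts, *Complex Geometry* (2005), Prop. 2.6.11,
`H⁰(X, Ω^p) = {α ∈ A^{p,0}(X) | ∂̄α = 0}`, read in one holomorphic chart; C. Voisin (2002), §2.3.1:
"in holomorphic coordinates `η = Σ η_I dz_I` with holomorphic `η_I`"):

* `inChart_dolbeaultBar_eq_typeProjAt_extDeriv` — `(∂̄α)̂(y) = (d α̂)^{p,q+1}(y)` on `C` for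
  `α ∈ A^{p,q}(chartSet x₀ C)` (localisation by bumps + the chart readings
  `represents_typeComponent`, `inChart_mextDeriv_of_mem_target` of the tree);
* `isOfTypeAt_inChart` — the representative has values of pointwise type `(p,q)` on `C`;
* `differentiableOn_inChart_of_localDbar_eq_zero` — **(→)** a `∂̄`-closed `(p,0)`-form on the
  chart set has a complex-differentiable representative on `C`
  (`differentiableOn_complex_of_typeProjAt_extDeriv_eq_zero` of `HolomorphicFlatForms`);
* `ofChartOn_mem_pqFormsOn`, `localDbar_ofChartOn_eq_zero` — **(←)** a complex-differentiable
  `F : C → Λ^{p,0}` transports to a `∂̄`-closed `(p,0)`-form on the chart set;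
* `ofChartOn_inChart` — the two directions are mutually inverse (`MForm.inChart_ofChartOn` is the
  other identity), `eq_of_inChart_eqOn` — a form on the chart set is determined by its
  representative on `C`.

Everything is proved; no definitions.

## References

* D. Huybrechts, *Complex Geometry* (2005), Prop. 2.6.11. [HuybrechtsCG2005]
* C. Voisin, *Hodge Theory and Complex Algebraic Geometry I* (2002), §2.3.1, §2.3.3.
  [VoisinHodgeI2002]
-/

noncomputable section

open scoped Manifold ContDiff Topology
open Set Filter Function Literature.NumberTheory.Transcendental Literature.Analysis.Complex

namespace Literature.Geometry.Kaehler

variable {E : Type*} [NormedAddCommGroup E] [NormedSpace ℂ E] {k : ℕ}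

/-! ### The frozen type projections agree -/

/-- The chart-side type projection `typeProjOp` of `ChartDolbeaultOps` is the flat `typeProjAt` of
`PQTypes` (both are the tree's averaging formula frozen on `E`). [folklore] -/
theorem typeProjOp_eq_typeProjAt (p q : ℕ) (a : E [⋀^Fin k]→L[ℝ] ℂ) :
    typeProjOp E k p q a = typeProjAt p q a := by
  rw [typeProjAt_eq]
  unfold typeProjOp
  split_ifs with h
  · simp only [weightProjOp, FunLike.coe_smul, Pi.smul_apply, FunLike.coe_sum,
      Finset.sum_apply, rotOp, rotateCLM, ContinuousAlternatingMap.compContinuousLinearMapCLM_apply]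
  · rfl

variable {M : Type*} [TopologicalSpace M] [ChartedSpace E M]
  [FiniteDimensional ℂ E] [T2Space M] [IsManifold 𝓘(ℂ, E) ω M] [IsManifold 𝓘(ℝ, E) ∞ M]
  {x₀ : M} {C : Set E} {p q : ℕ}

/-! ### Chart readings for forms on a chart set -/

omit [FiniteDimensional ℂ E] [T2Space M] in
/-- **The tangent coordinate change into the chart at `x₀` is `ℂ`-linear** (it commutes with the
rotations `e^{iθ}`): the inverse form of the tree's `tangentCoordChange_tangentRotate`, by the
cocycle identity. [cite: VoisinHodgeI2002, §2.2.1] -/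
theorem tangentCoordChange_tangentRotate_symm {x₀ x : M} (hx : x ∈ (extChartAt 𝓘(ℝ, E) x₀).source)
    (θ : ℝ) (u : E) :
    tangentCoordChange 𝓘(ℝ, E) x x₀ x (tangentRotate E x θ u) =
      tangentRotate E x θ (tangentCoordChange 𝓘(ℝ, E) x x₀ x u) := by
  have hxx : x ∈ (extChartAt 𝓘(ℝ, E) x).source := mem_extChartAt_source x
  have hinv : ∀ v : E, tangentCoordChange 𝓘(ℝ, E) x₀ x x (tangentCoordChange 𝓘(ℝ, E) x x₀ x v) = v :=
    fun v ↦ by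
      rw [tangentCoordChange_comp ⟨⟨hxx, hx⟩, hxx⟩]
      exact tangentCoordChange_self hxx
  have hinv' : ∀ v : E, tangentCoordChange 𝓘(ℝ, E) x x₀ x (tangentCoordChange 𝓘(ℝ, E) x₀ x x v) = v :=
    fun v ↦ by
      rw [tangentCoordChange_comp ⟨⟨hx, hxx⟩, hx⟩]
      exact tangentCoordChange_self hx
  have key := tangentCoordChange_tangentRotate (x₀ := x₀) (z := x) hx θ (tangentCoordChange 𝓘(ℝ, E) x x₀ x u)
  rw [hinv] at key
  calc tangentCoordChange 𝓘(ℝ, E) x x₀ x (tangentRotate E x θ u)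
      = tangentCoordChange 𝓘(ℝ, E) x x₀ x
          (tangentCoordChange 𝓘(ℝ, E) x₀ x x (tangentRotate E x θ (tangentCoordChange 𝓘(ℝ, E) x x₀ x u))) := by
        rw [key]
    _ = tangentRotate E x θ (tangentCoordChange 𝓘(ℝ, E) x x₀ x u) := hinv' _

/-- **The representative of a form on the chart set has values of type `(p,q)` on `C`** (the
tangent coordinate changes of a holomorphic atlas are `ℂ`-linear: `represents_typeComponent`).
[cite: VoisinHodgeI2002, §2.3.1] -/
theorem isOfTypeAt_inChart (hCt : C ⊆ (extChartAt 𝓘(ℝ, E) x₀).target) (hC : IsOpen C)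
    {α : MForm 𝓘(ℝ, E) M ℂ (p + q)} (hα : α ∈ pqFormsOn E M (chartSet 𝓘(ℝ, E) x₀ C) p q)
    {y : E} (hy : y ∈ C) : IsOfTypeAt p q (α.inChart x₀ y) := by
  have hyt := hCt hy
  have hx := symm_mem_chartSet hCt hy
  obtain ⟨β, hβs, hβt, hβα⟩ := exists_smooth_eventuallyEq (isOpen_chartSet 𝓘(ℝ, E) x₀ hC) hα hx
  -- representatives agree at `y`
  have heq : α.inChart x₀ y = β.inChart x₀ y := by
    rw [MForm.inChart_eq_of_mem_target _ hyt, MForm.inChart_eq_of_mem_target _ hyt, hβα.self_of_nhds]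
  -- `β = β^{p,q}`, read in the chart
  have h1 : (β.typeComponent p q).inChart x₀ y = typeProjAt p q (β.inChart x₀ y) := by
    rw [(represents_typeComponent x₀ p q).inChart_eq hβs hyt, ChartOp1.applyAt_ofCLM, typeProjOp_eq_typeProjAt]
  rw [hβt.typeComponent_eq_self] at h1
  rw [heq]
  exact (isOfTypeAt_iff_typeProjAt_eq_self hβt.1 _).2 h1.symm

/-- **`∂̄` read in the chart**: for a `(p,q)`-form `α` on the chart set of `C` and `y ∈ C`,
`(∂̄α)̂(y) = (d α̂)^{p,q+1}(y)` — the representative of `∂̄α` is the `(p,q+1)`-projection of the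
flat exterior derivative of the representative (localise by a bump, `∂̄α = (dα)^{p,q+1}`, the
chart readings of the type projections and of `d`). [cite: VoisinHodgeI2002, §2.3.3] -/
theorem inChart_dolbeaultBar_eq_typeProjAt_extDeriv (hCt : C ⊆ (extChartAt 𝓘(ℝ, E) x₀).target)
    (hC : IsOpen C) {α : MForm 𝓘(ℝ, E) M ℂ (p + q)} (hα : α ∈ pqFormsOn E M (chartSet 𝓘(ℝ, E) x₀ C) p q)
    {y : E} (hy : y ∈ C) :
    (dolbeaultBar α).inChart x₀ y = typeProjAt p (q + 1) (extDeriv (α.inChart x₀) y) := by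
  have hyt := hCt hy
  have hx := symm_mem_chartSet hCt hy
  obtain ⟨β, hβs, hβt, hβα⟩ := exists_smooth_eventuallyEq (isOpen_chartSet 𝓘(ℝ, E) x₀ hC) hα hx
  -- `∂̄α = ∂̄β` at the point, hence same representative at `y`
  have h1 : (dolbeaultBar α).inChart x₀ y = (dolbeaultBar β).inChart x₀ y := by
    rw [MForm.inChart_eq_of_mem_target _ hyt, MForm.inChart_eq_of_mem_target _ hyt,
      dolbeaultBar_congr_of_eventuallyEq hβα]
  -- `∂̄β = (dβ)^{p,q+1}` read in the chart
  have h2 : (dolbeaultBar β).inChart x₀ y = typeProjAt p (q + 1) ((mextDeriv β).inChart x₀ y) := by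
    rw [IsOfType.dolbeaultBar_eq_holds hβt, (represents_typeComponent x₀ p (q + 1)).inChart_eq hβs.mextDeriv hyt,
      ChartOp1.applyAt_ofCLM, typeProjOp_eq_typeProjAt]
  -- `dβ` read in the chart, and the representatives of `α`, `β` agree near `y`
  have h3 : (mextDeriv β).inChart x₀ y = extDeriv (β.inChart x₀) y := by
    rw [inChart_mextDeriv_of_mem_target β hyt (hβs _), ModelWithCorners.Boundaryless.range_eq_univ,
      extDerivWithin_univ]
  have h4 : β.inChart x₀ =ᶠ[𝓝 y] α.inChart x₀ := by
    have h := MForm.inChart_eventuallyEq ((extChartAt 𝓘(ℝ, E) x₀).map_target hyt) hβα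
    rwa [(extChartAt 𝓘(ℝ, E) x₀).right_inv hyt] at h
  rw [h1, h2, h3, h4.extDeriv_eq]

/-! ### (→) `∂̄`-closed `(p,0)`-forms on the chart set have holomorphic representatives -/

/-- **A `∂̄`-closed `(p,0)`-form on the chart set of an open `C` has a complex-differentiable chart
representative on `C`** (Huybrechts (2005), Prop. 2.6.11 in a holomorphic chart).
[cite: HuybrechtsCG2005, Prop. 2.6.11] -/
theorem differentiableOn_inChart_of_localDbar_eq_zero (hCt : C ⊆ (extChartAt 𝓘(ℝ, E) x₀).target)
    (hC : IsOpen C) (α : ↥(pqFormsOn E M (chartSet 𝓘(ℝ, E) x₀ C) p 0))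
    (hα : localDbar E M (isOpen_chartSet 𝓘(ℝ, E) x₀ hC) p 0 α = 0) :
    DifferentiableOn ℂ ((α : MForm 𝓘(ℝ, E) M ℂ (p + 0)).inChart x₀) C := by
  have hd : DifferentiableOn ℝ ((α : MForm 𝓘(ℝ, E) M ℂ (p + 0)).inChart x₀) C :=
    (contDiffOn_inChart_of_mem_smoothFormsOn hCt (mem_smoothFormsOn_of_mem_pqFormsOn α.2)).differentiableOn
      (by simp)
  refine differentiableOn_complex_of_typeProjAt_extDeriv_eq_zero hC hd
    (fun y hy ↦ isOfTypeAt_inChart hCt hC α.2 hy) fun y hy ↦ ?_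
  -- `∂̄α` vanishes at the point, hence its representative at `y`
  have h0 : dolbeaultBar (α : MForm 𝓘(ℝ, E) M ℂ (p + 0)) ((extChartAt 𝓘(ℝ, E) x₀).symm y) = 0 := by
    have h := congrArg (fun γ : ↥(pqFormsOn E M (chartSet 𝓘(ℝ, E) x₀ C) p (0 + 1)) ↦
      (γ : MForm 𝓘(ℝ, E) M ℂ (p + (0 + 1))) ((extChartAt 𝓘(ℝ, E) x₀).symm y)) hα
    simp only [coe_localDbar, MForm.restr_apply_of_mem _ (symm_mem_chartSet hCt hy), ZeroMemClass.coe_zero,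
      Pi.zero_apply] at h
    exact h
  rw [← inChart_dolbeaultBar_eq_typeProjAt_extDeriv hCt hC α.2 hy]
  exact MForm.inChart_eq_zero_of_apply_eq_zero (hCt hy) h0

/-! ### (←) holomorphic maps on `C` transport to `∂̄`-closed `(p,0)`-forms on the chart set -/

omit [T2Space M] in
/-- **The transport of a complex-differentiable `F : C → Λ^{p,0}` is a `(p,0)`-form on the chart
set** (smooth: holomorphic maps are `C^∞`; type: the tangent coordinate changes of a holomorphic
atlas commute with the rotations). [cite: HuybrechtsCG2005, Prop. 2.6.11] -/
theorem ofChartOn_mem_pqFormsOn (hCt : C ⊆ (extChartAt 𝓘(ℝ, E) x₀).target) (hC : IsOpen C)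
    {F : E → E [⋀^Fin (p + 0)]→L[ℝ] ℂ} (hF : DifferentiableOn ℂ F C) (ht : ∀ y ∈ C, IsOfTypeAt p 0 (F y)) :
    (MForm.ofChartOn x₀ (chartSet 𝓘(ℝ, E) x₀ C) F : MForm 𝓘(ℝ, E) M ℂ (p + 0)) ∈
      pqFormsOn E M (chartSet 𝓘(ℝ, E) x₀ C) p 0 := by
  have hFs : ContDiffOn ℝ ∞ F C := contDiffOn_real_of_differentiableOn hF hC
  have hsm := ofChartOn_mem_smoothFormsOn (I := 𝓘(ℝ, E)) (F := ℂ) hC hCt hFs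
  refine ⟨hsm.1, hsm.2, ⟨rfl, fun x θ v ↦ ?_⟩⟩
  by_cases hx : x ∈ chartSet 𝓘(ℝ, E) x₀ C
  · rw [MForm.ofChartOn_apply_of_mem x₀ F hx, MForm.ofChartOn_apply_of_mem x₀ F hx]
    have hlin : ∀ u : E, tangentCoordChange 𝓘(ℝ, E) x x₀ x (tangentRotate E x θ u) =
        tangentRotate E x θ (tangentCoordChange 𝓘(ℝ, E) x x₀ x u) := fun u ↦
      tangentCoordChange_tangentRotate_symm hx.1 θ u
    simp only [hlin]
    exact (ht _ hx.2).2 θ _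
  · have h0 : (MForm.ofChartOn x₀ (chartSet 𝓘(ℝ, E) x₀ C) F : MForm 𝓘(ℝ, E) M ℂ (p + 0)) x = 0 :=
      MForm.ofChartOn_apply_of_notMem x₀ F hx
    simp [h0]

/-- **The transport of a complex-differentiable `F : C → Λ^{p,0}` is `∂̄`-closed on the chart set**
(`(dF)^{p,1} = 0` for holomorphic `F`, `typeProjAt_extDeriv_eq_zero_of_differentiableOn_complex`,
read back through the chart). [cite: HuybrechtsCG2005, Prop. 2.6.11] -/
theorem localDbar_ofChartOn_eq_zero (hCt : C ⊆ (extChartAt 𝓘(ℝ, E) x₀).target) (hC : IsOpen C)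
    {F : E → E [⋀^Fin (p + 0)]→L[ℝ] ℂ} (hF : DifferentiableOn ℂ F C) (ht : ∀ y ∈ C, IsOfTypeAt p 0 (F y)) :
    localDbar E M (isOpen_chartSet 𝓘(ℝ, E) x₀ hC) p 0
      ⟨MForm.ofChartOn x₀ (chartSet 𝓘(ℝ, E) x₀ C) F, ofChartOn_mem_pqFormsOn hCt hC hF ht⟩ = 0 := by
  refine Subtype.ext (funext fun x ↦ ?_)
  rw [coe_localDbar, ZeroMemClass.coe_zero, Pi.zero_apply]
  by_cases hx : x ∈ chartSet 𝓘(ℝ, E) x₀ C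
  · rw [MForm.restr_apply_of_mem _ hx]
    -- read `∂̄` in the chart at `y = e x`
    set y := extChartAt 𝓘(ℝ, E) x₀ x with hy
    have hyC : y ∈ C := hx.2
    have hxy : (extChartAt 𝓘(ℝ, E) x₀).symm y = x := (extChartAt 𝓘(ℝ, E) x₀).left_inv hx.1
    have h1 := inChart_dolbeaultBar_eq_typeProjAt_extDeriv hCt hC (ofChartOn_mem_pqFormsOn hCt hC hF ht) hyC
    have h2 : extDeriv ((MForm.ofChartOn x₀ (chartSet 𝓘(ℝ, E) x₀ C) F : MForm 𝓘(ℝ, E) M ℂ (p + 0)).inChart x₀) y =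
        extDeriv F y := (MForm.inChart_ofChartOn_eventuallyEq hC hCt F hyC).extDeriv_eq
    rw [h2, typeProjAt_extDeriv_eq_zero_of_differentiableOn_complex hC hF ht hyC] at h1
    have h3 := MForm.apply_symm_eq_of_inChart_eq (β := (0 : MForm 𝓘(ℝ, E) M ℂ (p + 0 + 1))) (hCt hyC)
      (by rw [h1, MForm.inChart_zero]; rfl)
    rwa [hxy] at h3
  · rw [MForm.restr_apply_of_notMem _ hx]

/-! ### The two directions are mutually inverse -/

omit [FiniteDimensional ℂ E] [T2Space M] [IsManifold 𝓘(ℂ, E) ω M] in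
/-- **Reconstruction of a form on the chart set from its representative**:
`ofChartOn x₀ (chartSet x₀ C) (α̂) = α`. [folklore] -/
theorem ofChartOn_inChart (hCt : C ⊆ (extChartAt 𝓘(ℝ, E) x₀).target) {α : MForm 𝓘(ℝ, E) M ℂ (p + q)}
    (hα : α ∈ pqFormsOn E M (chartSet 𝓘(ℝ, E) x₀ C) p q) :
    (MForm.ofChartOn x₀ (chartSet 𝓘(ℝ, E) x₀ C) (α.inChart x₀) : MForm 𝓘(ℝ, E) M ℂ (p + q)) = α := by
  funext x
  by_cases hx : x ∈ chartSet 𝓘(ℝ, E) x₀ C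
  · have hyC : extChartAt 𝓘(ℝ, E) x₀ x ∈ C := hx.2
    have h := MForm.apply_symm_eq_of_inChart_eq (hCt hyC)
      (MForm.inChart_ofChartOn (I := 𝓘(ℝ, E)) hCt (α.inChart x₀) hyC)
    rwa [(extChartAt 𝓘(ℝ, E) x₀).left_inv hx.1] at h
  · rw [MForm.ofChartOn_apply_of_notMem x₀ _ hx, hα.2.1 x hx]

omit [FiniteDimensional ℂ E] [T2Space M] [IsManifold 𝓘(ℂ, E) ω M] in
/-- The transport only depends on the values of the data on `C`. [folklore] -/
theorem ofChartOn_congr {F G : E → E [⋀^Fin k]→L[ℝ] ℂ} (h : EqOn F G C) :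
    (MForm.ofChartOn x₀ (chartSet 𝓘(ℝ, E) x₀ C) F : MForm 𝓘(ℝ, E) M ℂ k) =
      MForm.ofChartOn x₀ (chartSet 𝓘(ℝ, E) x₀ C) G := by
  funext x
  by_cases hx : x ∈ chartSet 𝓘(ℝ, E) x₀ C
  · ext v
    rw [MForm.ofChartOn_apply_of_mem x₀ F hx, MForm.ofChartOn_apply_of_mem x₀ G hx, h hx.2]
  · rw [MForm.ofChartOn_apply_of_notMem x₀ F hx, MForm.ofChartOn_apply_of_notMem x₀ G hx]

omit [FiniteDimensional ℂ E] [T2Space M] [IsManifold 𝓘(ℂ, E) ω M] in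
/-- **A form on the chart set is determined by its representative on `C`.** [folklore] -/
theorem eq_of_inChart_eqOn (hCt : C ⊆ (extChartAt 𝓘(ℝ, E) x₀).target) {α β : MForm 𝓘(ℝ, E) M ℂ (p + q)}
    (hα : α ∈ pqFormsOn E M (chartSet 𝓘(ℝ, E) x₀ C) p q) (hβ : β ∈ pqFormsOn E M (chartSet 𝓘(ℝ, E) x₀ C) p q)
    (h : EqOn (α.inChart x₀) (β.inChart x₀) C) : α = β := by
  rw [← ofChartOn_inChart hCt hα, ← ofChartOn_inChart hCt hβ]
  exact ofChartOn_congr h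

end Literature.Geometry.Kaehler

end
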